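import Literature.NumberTheory.NumberFields.SqrtTwoTowerOrderFourClassCertificate
import Literature.NumberTheory.IwasawaTheory.CyclotomicTwoLayerThreeNonNormUnit
import HarnessLib

/-!
# The Galois action on the two-step `√2`-tower `K ⊂ K₁ ⊂ L` (`s₁² = 2`, `s₂² = 2 + s₁`): the generator `σ` with `σ(s₂) = s₂³ − 3s₂` of the cyclic group
# `Gal(L/K)` of order `4`, its iterates, the residue-symbol obstruction «`(b₀, s₂ − t) ≠ (1)`», the square of a two-generated ideal, and the norm through the tower

`Proofs`-style file (theorems only: no definition, no named fact, no instance, no `sorry`) in topic `NumberTheory/NumberFields` (namespace = path),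
written by the prover seat `bsd-line-att-p4` g43 (cell `bsd-f1-sign2`, route `AlignedTransportAtTwo`; `--supports` stmt-BirchSwinnertonDyer-22298, closes nothing).
The layer-TWO sibling of this seat's `SqrtTwoTowerThreeGaloisAction` (layer three), on att-p4 g41's four-coordinate calculus `SqrtTwoTowerOrderFourClassCertificate`
(`exists_coord4_of_tower`, `coord4_unique_of_tower`, `coord4_mul_of_tower`, `exists_sixteen_mul_eq_coord4_of_isIntegral`); it is the Galois input of RELATION
certificates `∏ σ^i(𝔠)^{f_i} = (y)` in the degree-`12` layer `K_2 = K·ℚ(ζ₁₆)⁺` (att-p3 g48/g49's relation doors).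

* `span_pair_sq_eq_span_pair_sq_of_eq` — in any commutative ring: `x b² + e (b w) + z w² = b ⟹ (b, w)² = (b, w²)`.
* ★ `algEquiv_eq_of_apply_eq_tower2`, ★★ `exists_algEquiv_apply_eq_tower2` (there is `σ ∈ Gal(L/K)` with `σ(s₂) = s₂³ − 3s₂`: the four values `τ(s₂)` are the four
  roots of `P₂ = (X²−2)²−2`), ★ `tower2_galois_iterates` (`σ s₁ = −s₁`, `σ s₂ = s₁s₂ − s₂`, `σ² s₂ = −s₂`, `σ³ s₂ = s₂ − s₁s₂`),
  ★★ `forall_mem_zpowers_of_apply_eq_tower2` (`σ` has order `4` and generates `Gal(L/K)`; no cyclicity input).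
* ★★ `span_pair_ne_top_of_residue_tower2` — `b₀ ∈ 𝓞_K`, `t ∈ ℤ`, `ψ : 𝓞_K → ℤ/q` (`q > 1`, `2` invertible) with `ψ(b₀) = 0` and `P₂(t) = 0` in `ℤ/q`
  ⟹ the ideal `(b₀, s₂ − t)` of `𝓞_L` is proper (g41's `16·𝓞_L ⊆ Σ 𝓞_K bᵢ` + product rule + the symbol `x ↦ Σ ψ(xᵢ) rᵢ`).
* ★ `norm_tower2_eq` — `N_{L/K}(x₀ + x₁s₁ + (x₂ + x₃s₁)s₂) = V₀² − 2V₁²`, `V₀ = x₀² + 2x₁² − 2x₂² − 4x₃² − 4x₂x₃`, `V₁ = 2x₀x₁ − x₂² − 2x₃² − 4x₂x₃`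
  (att-p3 g49's `norm_add_mul_eq_sq_sub_mul_sq` twice + `Algebra.norm_norm`).

HONEST SCOPE: elementary Galois theory and commutative algebra of the tower; nothing specific to any summit; no field is certified; BSD is not advanced here.

References: [NeukirchANT1999] Ch. I §2 (bases, conjugates, norm as product of conjugates), Ch. I §8, Ch. IV §1; [Washington1997] §13.1 (`ℚ_2 = ℚ(ζ₁₆)⁺ = ℚ(2cos(π/8))`,
cyclic of order `4`); [Marcus2018] Ch. 3 Thm. 27; [Cohen1993] §4.7 (two-element representation of ideals), §6.5; [Omeara1963] §63B.
-/

set_option autoImplicit false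

noncomputable section

open scoped NumberField nonZeroDivisors
open NumberField Module Polynomial

namespace Literature.NumberTheory.NumberFields

open Literature.NumberTheory.IwasawaTheory

/-! ## §0 The square of a two-generated ideal -/

section Algebra

variable {R : Type*} [CommRing R]

/-- **`(b, w)² = (b, w²)` when `b ∈ (b², bw, w²)`** (witness `x b² + e·(b w) + z w² = b`). [cite: Cohen1993, §4.7 (operations on two-element representations)] -/
theorem span_pair_sq_eq_span_pair_sq_of_eq {x b e w z : R} (h : x * b ^ 2 + e * (b * w) + z * w ^ 2 = b) :
    Ideal.span {b, w} ^ 2 = Ideal.span {b, w ^ 2} := by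
  have hb : b ∈ Ideal.span {b, w} := Ideal.subset_span (by simp)
  have hw : w ∈ Ideal.span {b, w} := Ideal.subset_span (by simp)
  rw [pow_two]
  apply le_antisymm
  · rw [Ideal.span_pair_mul_span_pair, Ideal.span_le]
    intro y hy
    simp only [Set.mem_insert_iff, Set.mem_singleton_iff] at hy
    rcases hy with rfl | rfl | rfl | rfl
    · exact Ideal.mul_mem_left _ _ (Ideal.subset_span (by simp))
    · exact Ideal.mul_mem_right _ _ (Ideal.subset_span (by simp))
    · exact Ideal.mul_mem_left _ _ (Ideal.subset_span (by simp))
    · rw [← pow_two]; exact Ideal.subset_span (by simp)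
  · rw [Ideal.span_le]
    intro y hy
    simp only [Set.mem_insert_iff, Set.mem_singleton_iff] at hy
    have key : x * b ^ 2 + e * (b * w) + z * w ^ 2 ∈ Ideal.span {b, w} * Ideal.span {b, w} := by
      refine Ideal.add_mem _ (Ideal.add_mem _ ?_ ?_) ?_
      · rw [pow_two]; exact Ideal.mul_mem_left _ _ (Ideal.mul_mem_mul hb hb)
      · exact Ideal.mul_mem_left _ _ (Ideal.mul_mem_mul hb hw)
      · rw [pow_two]; exact Ideal.mul_mem_left _ _ (Ideal.mul_mem_mul hw hw)
    rw [h] at key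
    rcases hy with rfl | rfl
    · exact key
    · rw [SetLike.mem_coe, pow_two]; exact Ideal.mul_mem_mul hw hw

end Algebra

/-! ## §1 The Galois group of the two-step tower: the automorphism `s₂ ↦ s₂³ − 3s₂` and its iterates -/

section Tower2Galois

variable {K K₁ L : Type*} [Field K] [Field K₁] [Field L] [Algebra K K₁] [Algebra K₁ L] [Algebra K L] [IsScalarTower K K₁ L]

/-- ★ **An element of `Gal(L/K)` is determined by its value at `s₂`** (`s₁ = s₂² − 2` and every `z ∈ L` has `K`-coordinates on `1, s₁, s₂, s₁s₂`).
[cite: NeukirchANT1999, Ch. I §2] -/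
theorem algEquiv_eq_of_apply_eq_tower2 (h1 : Module.finrank K K₁ = 2) (h2 : Module.finrank K₁ L = 2)
    {s₁ : K₁} (hs₁K : ∀ k : K, algebraMap K K₁ k ≠ s₁)
    {s₂ : L} (hs₂ : s₂ ^ 2 = algebraMap K₁ L (2 + s₁)) (hs₂K : ∀ x : K₁, algebraMap K₁ L x ≠ s₂)
    {τ τ' : L ≃ₐ[K] L} (h : τ s₂ = τ' s₂) : τ = τ' := by
  have hS₁ : algebraMap K₁ L s₁ = s₂ ^ 2 - 2 := by rw [hs₂, map_add, map_ofNat]; ring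
  have h₁ : τ (algebraMap K₁ L s₁) = τ' (algebraMap K₁ L s₁) := by
    rw [hS₁, map_sub, map_sub, map_pow, map_pow, h, map_ofNat, map_ofNat]
  apply AlgEquiv.ext
  intro z
  obtain ⟨x₀, x₁, x₂, x₃, rfl⟩ := exists_coord4_of_tower h1 h2 hs₁K hs₂K z
  simp only [map_add, map_mul, AlgEquiv.commutes, h, h₁]

set_option maxHeartbeats 800000 in
/-- ★★ **The automorphism `s₂ ↦ s₂³ − 3s₂` exists.**  `L/K` Galois, `[K₁:K] = [L:K₁] = 2`, `s₁ ∉ K`, `s₂ ∉ K₁`: `τ ↦ τ(s₂)` is injective on `Gal(L/K)`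
(four elements) with values among the roots of `P₂ = (X²−2)²−2` (at most four), so every root of `P₂` in `L` — in particular `s₂³ − 3s₂` — is a `τ(s₂)`.
[cite: Washington1997, §13.1] [cite: NeukirchANT1999, Ch. IV §1] -/
theorem exists_algEquiv_apply_eq_tower2 [FiniteDimensional K L] [IsGalois K L]
    (h1 : Module.finrank K K₁ = 2) (h2 : Module.finrank K₁ L = 2)
    {s₁ : K₁} (hs₁ : s₁ ^ 2 = 2) (hs₁K : ∀ k : K, algebraMap K K₁ k ≠ s₁)
    {s₂ : L} (hs₂ : s₂ ^ 2 = algebraMap K₁ L (2 + s₁)) (hs₂K : ∀ x : K₁, algebraMap K₁ L x ≠ s₂) :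
    ∃ σ : L ≃ₐ[K] L, σ s₂ = s₂ ^ 3 - 3 * s₂ := by
  classical
  haveI : FiniteDimensional K K₁ := Module.finite_of_finrank_pos (by rw [h1]; norm_num)
  haveI : FiniteDimensional K₁ L := Module.finite_of_finrank_pos (by rw [h2]; norm_num)
  set S₁ : L := algebraMap K₁ L s₁ with hS₁def
  have hS₁ : S₁ ^ 2 = 2 := by rw [hS₁def, ← map_pow, hs₁, map_ofNat]
  have hS₂ : s₂ ^ 2 = 2 + S₁ := by rw [hs₂, map_add, map_ofNat]
  have hcard : Nat.card (L ≃ₐ[K] L) = 4 := by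
    rw [IsGalois.card_aut_eq_finrank, ← Module.finrank_mul_finrank K K₁ L, h1, h2]
  set P : L[X] := (X ^ 2 - C 2) ^ 2 - C 2 with hP
  have hPdeg : P.natDegree = 4 := by rw [hP]; compute_degree!
  have hP0 : P ≠ 0 := by
    intro h0
    rw [h0, natDegree_zero] at hPdeg
    exact absurd hPdeg (by norm_num)
  have hevalP : ∀ x : L, P.eval x = (x ^ 2 - 2) ^ 2 - 2 := fun x => by
    simp only [hP, eval_sub, eval_pow, eval_X, eval_C]
  have hτS₁ : ∀ τ : L ≃ₐ[K] L, τ S₁ = (τ s₂) ^ 2 - 2 := fun τ => by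
    have : S₁ = s₂ ^ 2 - 2 := by rw [hS₂]; ring
    rw [this, map_sub, map_pow, map_ofNat]
  have hroot : ∀ τ : L ≃ₐ[K] L, τ s₂ ∈ P.roots.toFinset := fun τ => by
    rw [Multiset.mem_toFinset, mem_roots hP0, IsRoot.def, hevalP]
    have hsq : (τ S₁) ^ 2 = 2 := by rw [← map_pow, hS₁, map_ofNat]
    rw [← hτS₁ τ, hsq, sub_self]
  have hinj : Function.Injective fun τ : L ≃ₐ[K] L => τ s₂ := fun τ τ' hττ' =>
    algEquiv_eq_of_apply_eq_tower2 h1 h2 hs₁K hs₂ hs₂K hττ'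
  have himg : Finset.univ.image (fun τ : L ≃ₐ[K] L => τ s₂) = P.roots.toFinset := by
    apply Finset.eq_of_subset_of_card_le
    · intro x hx
      obtain ⟨τ, -, rfl⟩ := Finset.mem_image.mp hx
      exact hroot τ
    · rw [Finset.card_image_of_injective _ hinj, Finset.card_univ, ← Nat.card_eq_fintype_card, hcard]
      exact (Multiset.toFinset_card_le _).trans ((card_roots' P).trans hPdeg.le)
  have hu : s₂ ^ 3 - 3 * s₂ ∈ P.roots.toFinset := by
    rw [Multiset.mem_toFinset, mem_roots hP0, IsRoot.def, hevalP]
    have hu2 : (s₂ ^ 3 - 3 * s₂) ^ 2 = 2 - S₁ := by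
      linear_combination (3 + (-2) * S₁ + (-4) * s₂ ^ 2 + S₁ * s₂ ^ 2 + s₂ ^ 4) * hS₂ + ((-2) + s₂ ^ 2) * hS₁
    rw [hu2, show (2 - S₁ - 2 : L) = -S₁ by ring, neg_sq, hS₁, sub_self]
  rw [← himg] at hu
  obtain ⟨σ, -, hσ⟩ := Finset.mem_image.mp hu
  exact ⟨σ, hσ⟩

omit [Algebra K K₁] [IsScalarTower K K₁ L] in
/-- ★ **The iterates of `σ` (`σ s₂ = s₂³ − 3s₂`)**: `σ s₁ = −s₁`, `σ s₂ = s₁s₂ − s₂`, `σ² s₂ = −s₂`, `σ³ s₂ = s₂ − s₁s₂`.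
[cite: Washington1997, §13.1 (`Gal(ℚ(ζ₁₆)⁺/ℚ)`: `ζ ↦ ζ³` generates)] -/
theorem tower2_galois_iterates {s₁ : K₁} (hs₁ : s₁ ^ 2 = 2) {s₂ : L} (hs₂ : s₂ ^ 2 = algebraMap K₁ L (2 + s₁))
    {σ : L ≃ₐ[K] L} (hσ : σ s₂ = s₂ ^ 3 - 3 * s₂) :
    σ (algebraMap K₁ L s₁) = -algebraMap K₁ L s₁ ∧ σ s₂ = algebraMap K₁ L s₁ * s₂ - s₂ ∧ (σ ^ 2) s₂ = -s₂ ∧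
      (σ ^ 3) s₂ = s₂ - algebraMap K₁ L s₁ * s₂ := by
  set S₁ : L := algebraMap K₁ L s₁ with hS₁def
  have hS₁ : S₁ ^ 2 = 2 := by rw [hS₁def, ← map_pow, hs₁, map_ofNat]
  have hS₂ : s₂ ^ 2 = 2 + S₁ := by rw [hs₂, map_add, map_ofNat]
  have h1' : σ s₂ = S₁ * s₂ - s₂ := by rw [hσ]; linear_combination (s₂) * hS₂
  have h2' : σ S₁ = -S₁ := by
    have : S₁ = s₂ ^ 2 - 2 := by rw [hS₂]; ring
    rw [congrArg σ this, map_sub, map_pow, map_ofNat, hσ]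
    linear_combination (3 + (-2) * S₁ + (-4) * s₂ ^ 2 + S₁ * s₂ ^ 2 + s₂ ^ 4) * hS₂ + ((-2) + s₂ ^ 2) * hS₁
  have hp2 : (σ ^ 2) s₂ = -s₂ := by
    rw [pow_two, AlgEquiv.mul_apply, h1', map_sub, map_mul, h2', h1']
    linear_combination ((-1) * s₂) * hS₁
  have hp3 : (σ ^ 3) s₂ = s₂ - S₁ * s₂ := by
    rw [pow_succ', AlgEquiv.mul_apply, hp2, map_neg, h1']; ring
  exact ⟨h2', h1', hp2, hp3⟩

/-- ★★ **`σ` generates `Gal(L/K)`**: `σ² s₂ = −s₂ ≠ s₂`, so `σ` has order `4 = #Gal(L/K)`. [cite: Washington1997, §13.1] [cite: NeukirchANT1999, Ch. IV §1] -/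
theorem forall_mem_zpowers_of_apply_eq_tower2 [FiniteDimensional K L] [IsGalois K L]
    (h1 : Module.finrank K K₁ = 2) (h2 : Module.finrank K₁ L = 2)
    {s₁ : K₁} (hs₁ : s₁ ^ 2 = 2) (hs₁K : ∀ k : K, algebraMap K K₁ k ≠ s₁)
    {s₂ : L} (hs₂ : s₂ ^ 2 = algebraMap K₁ L (2 + s₁))
    {σ : L ≃ₐ[K] L} (hσ : σ s₂ = s₂ ^ 3 - 3 * s₂) :
    ∀ τ : L ≃ₐ[K] L, τ ∈ Subgroup.zpowers σ := by
  classical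
  haveI : FiniteDimensional K K₁ := Module.finite_of_finrank_pos (by rw [h1]; norm_num)
  haveI : FiniteDimensional K₁ L := Module.finite_of_finrank_pos (by rw [h2]; norm_num)
  have hcard : Nat.card (L ≃ₐ[K] L) = 4 := by
    rw [IsGalois.card_aut_eq_finrank, ← Module.finrank_mul_finrank K K₁ L, h1, h2]
  have hs₂0 : s₂ ≠ 0 := by
    intro h0
    have h22 : algebraMap K₁ L (2 + s₁) = 0 := by rw [← hs₂, h0]; ring
    rw [map_eq_zero_iff _ (algebraMap K₁ L).injective] at h22
    exact hs₁K (-2) (by rw [map_neg, map_ofNat]; linear_combination (-1) * h22)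
  have h2ne : (2 : L) ≠ 0 := by
    intro h0
    have h0' : algebraMap K₁ L 2 = 0 := by rw [map_ofNat, h0]
    rw [map_eq_zero_iff _ (algebraMap K₁ L).injective] at h0'
    have hsq : s₁ ^ 2 = 0 := by rw [hs₁, h0']
    exact hs₁K 0 (by rw [map_zero]; exact (pow_eq_zero_iff two_ne_zero).mp hsq |>.symm)
  have hp2 := (tower2_galois_iterates (K := K) hs₁ hs₂ hσ).2.2.1
  have hne : σ ^ 2 ≠ 1 := by
    intro h
    rw [h, AlgEquiv.one_apply] at hp2
    have h2s : (2 : L) * s₂ = 0 := by linear_combination hp2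
    exact hs₂0 ((mul_eq_zero.mp h2s).resolve_left h2ne)
  have hdvd : orderOf σ ∣ 2 ^ 2 := by
    have h := orderOf_dvd_natCard σ
    rw [hcard] at h
    exact h
  have hord : orderOf σ = 4 := by
    obtain ⟨k, hk, hk'⟩ := (Nat.dvd_prime_pow Nat.prime_two).mp hdvd
    have hk2 : ¬ orderOf σ ∣ 2 := fun h4 => hne (orderOf_dvd_iff_pow_eq_one.mp h4)
    interval_cases k
    · exact absurd (by rw [hk']; norm_num) hk2
    · exact absurd (by rw [hk']; norm_num) hk2
    · rw [hk']; norm_num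
  have htop : Subgroup.zpowers σ = ⊤ := by
    apply Subgroup.eq_top_of_card_eq
    rw [Nat.card_zpowers, hord, hcard]
  intro τ
  rw [htop]
  exact Subgroup.mem_top τ

/-! ## §2 The norm through the two-step tower -/

/-- ★ **`N_{L/K}(x₀ + x₁s₁ + (x₂ + x₃s₁)s₂) = V₀² − 2V₁²`** with `V₀ = x₀² + 2x₁² − 2x₂² − 4x₃² − 4x₂x₃`, `V₁ = 2x₀x₁ − x₂² − 2x₃² − 4x₂x₃`
(`N_{L/K₁}(A + C s₂) = A² − (2+s₁)C²`, then `N_{K₁/K}(V₀ + V₁s₁) = V₀² − 2V₁²`; transitivity of the norm).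
[cite: NeukirchANT1999, Ch. I §2 Prop. (2.6) and Cor. (2.7) (norm as product of conjugates; transitivity)] [cite: Omeara1963, §63B (63:10)] -/
theorem norm_tower2_eq [FiniteDimensional K K₁] [IsGalois K K₁] [FiniteDimensional K₁ L] [IsGalois K₁ L]
    (h1 : Module.finrank K K₁ = 2) (h2 : Module.finrank K₁ L = 2)
    {s₁ : K₁} (hs₁ : s₁ ^ 2 = 2) (hs₁K : ∀ k : K, algebraMap K K₁ k ≠ s₁)
    {s₂ : L} (hs₂ : s₂ ^ 2 = algebraMap K₁ L (2 + s₁)) (hs₂K : ∀ x : K₁, algebraMap K₁ L x ≠ s₂) (x₀ x₁ x₂ x₃ : K) :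
    Algebra.norm K (algebraMap K L x₀ + algebraMap K L x₁ * algebraMap K₁ L s₁ + (algebraMap K L x₂ + algebraMap K L x₃ * algebraMap K₁ L s₁) * s₂) =
      (x₀ ^ 2 + 2 * x₁ ^ 2 - 2 * x₂ ^ 2 - 4 * x₃ ^ 2 - 4 * x₂ * x₃) ^ 2 - 2 * (2 * x₀ * x₁ - x₂ ^ 2 - 2 * x₃ ^ 2 - 4 * x₂ * x₃) ^ 2 := by
  haveI : FiniteDimensional K L := Module.Finite.trans K₁ L
  have hz : algebraMap K L x₀ + algebraMap K L x₁ * algebraMap K₁ L s₁ + (algebraMap K L x₂ + algebraMap K L x₃ * algebraMap K₁ L s₁) * s₂ =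
      algebraMap K₁ L (algebraMap K K₁ x₀ + algebraMap K K₁ x₁ * s₁) + algebraMap K₁ L (algebraMap K K₁ x₂ + algebraMap K K₁ x₃ * s₁) * s₂ := by
    simp only [map_add, map_mul, ← IsScalarTower.algebraMap_apply]
  have hs₁' : s₁ ^ 2 = algebraMap K K₁ 2 := by rw [hs₁, map_ofNat]
  rw [← Algebra.norm_norm (S := K₁), hz, norm_add_mul_eq_sq_sub_mul_sq h2 hs₂ hs₂K]
  have hV : (algebraMap K K₁ x₀ + algebraMap K K₁ x₁ * s₁) ^ 2 - (2 + s₁) * (algebraMap K K₁ x₂ + algebraMap K K₁ x₃ * s₁) ^ 2 =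
      algebraMap K K₁ (x₀ ^ 2 + 2 * x₁ ^ 2 - 2 * x₂ ^ 2 - 4 * x₃ ^ 2 - 4 * x₂ * x₃) + algebraMap K K₁ (2 * x₀ * x₁ - x₂ ^ 2 - 2 * x₃ ^ 2 - 4 * x₂ * x₃) * s₁ := by
    simp only [map_add, map_sub, map_mul, map_pow, map_ofNat]
    linear_combination (algebraMap K K₁ x₁ ^ 2 - algebraMap K K₁ x₃ ^ 2 * (2 + s₁) - 2 * algebraMap K K₁ x₂ * algebraMap K K₁ x₃) * hs₁
  rw [hV, norm_add_mul_eq_sq_sub_mul_sq h1 hs₁' hs₁K]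

end Tower2Galois

/-! ## §3 The residue-symbol obstruction: `(b₀, s₂ − t)` is a proper ideal of `𝓞_L` -/

section Residue2

variable {K K₁ L : Type*} [Field K] [Field K₁] [NumberField K₁] [Field L] [NumberField L]
  [Algebra K K₁] [Algebra K₁ L] [Algebra K L] [IsScalarTower K K₁ L]
  [FiniteDimensional K K₁] [IsGalois K K₁] [FiniteDimensional K₁ L] [IsGalois K₁ L]

set_option maxHeartbeats 800000 in
/-- ★★ **`(b₀, s₂ − t) ≠ (1)` in `𝓞_L` from a residue map of `𝓞_K`.**  `b₀ ∈ 𝓞_K`, `t ∈ ℤ`; `ψ : 𝓞_K → ℤ/q` (`q > 1`, `2` invertible) with `ψ(b₀) = 0` and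
`P₂(t) = (t²−2)²−2 = 0` in `ℤ/q`.  If `u b₀ + v (s₂ − t) = 1`, write `16u`, `16v` on the four `𝓞_K`-coordinates, expand by the product rule, compare coordinates and
apply the symbol `x ↦ Σ ψ(xᵢ)rᵢ` (`r₂ = t`, `r₁ = t² − 2`): the right side vanishes, the left is `16 ≠ 0`.
[cite: NeukirchANT1999, Ch. I §8 (residue fields of split primes)] [cite: Marcus2018, Ch. 3, Thm. 27] -/
theorem span_pair_ne_top_of_residue_tower2 (h1 : Module.finrank K K₁ = 2) (h2 : Module.finrank K₁ L = 2)
    {s₁ : K₁} (hs₁ : s₁ ^ 2 = 2) (hs₁K : ∀ k : K, algebraMap K K₁ k ≠ s₁)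
    {s₂ : L} (hs₂ : s₂ ^ 2 = algebraMap K₁ L (2 + s₁)) (hs₂K : ∀ x : K₁, algebraMap K₁ L x ≠ s₂)
    (b₀ : 𝓞 K) (t : ℤ) {q : ℕ} (hq : 1 < q) (ψ : 𝓞 K →+* ZMod q) (hψ : ψ b₀ = 0) {ti : ZMod q} (hti : 2 * ti = 1)
    (hPt : ((t : ZMod q) ^ 2 - 2) ^ 2 - 2 = 0) {S₂ : 𝓞 L} (hS₂ : algebraMap (𝓞 L) L S₂ = s₂) :
    Ideal.span {algebraMap (𝓞 K) (𝓞 L) b₀, S₂ - t} ≠ ⊤ := by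
  intro htop
  rw [Ideal.eq_top_iff_one, Ideal.mem_span_pair] at htop
  obtain ⟨u, v, huv⟩ := htop
  have hcoe : algebraMap (𝓞 L) L (algebraMap (𝓞 K) (𝓞 L) b₀) = algebraMap K L (b₀ : K) :=
    (IsScalarTower.algebraMap_apply (𝓞 K) (𝓞 L) L b₀).symm.trans (IsScalarTower.algebraMap_apply (𝓞 K) K L b₀)
  have huvL : algebraMap (𝓞 L) L u * algebraMap K L (b₀ : K) + algebraMap (𝓞 L) L v * (s₂ - t) = 1 := by
    have h := congrArg (algebraMap (𝓞 L) L) huv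
    rw [map_add, map_mul, map_mul, map_sub, map_intCast, map_one, hcoe, hS₂] at h
    exact h
  obtain ⟨a₀, a₁, a₂, a₃, ha⟩ := exists_sixteen_mul_eq_coord4_of_isIntegral h1 h2 hs₁ hs₁K hs₂ hs₂K
    (z := algebraMap (𝓞 L) L u) (RingOfIntegers.isIntegral_coe u)
  obtain ⟨b₁₀, b₁₁, b₁₂, b₁₃, hb⟩ := exists_sixteen_mul_eq_coord4_of_isIntegral h1 h2 hs₁ hs₁K hs₂ hs₂K
    (z := algebraMap (𝓞 L) L v) (RingOfIntegers.isIntegral_coe v)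
  have hS₁ : (algebraMap K₁ L s₁) ^ 2 = 2 := by rw [← map_pow, hs₁, map_ofNat]
  have hS₂' : s₂ ^ 2 = 2 + algebraMap K₁ L s₁ := by rw [hs₂, map_add, map_ofNat]
  have h16 : algebraMap K L ((a₀ : K) * (b₀ : K) + (2 * (b₁₂ : K) + 2 * (b₁₃ : K) - (b₁₀ : K) * t))
      + algebraMap K L ((a₁ : K) * (b₀ : K) + ((b₁₂ : K) + 2 * (b₁₃ : K) - (b₁₁ : K) * t)) * algebraMap K₁ L s₁
      + (algebraMap K L ((a₂ : K) * (b₀ : K) + ((b₁₀ : K) - (b₁₂ : K) * t)) + algebraMap K L ((a₃ : K) * (b₀ : K) + ((b₁₁ : K) - (b₁₃ : K) * t)) * algebraMap K₁ L s₁) * s₂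
      = algebraMap K L 16 + algebraMap K L 0 * algebraMap K₁ L s₁ + (algebraMap K L 0 + algebraMap K L 0 * algebraMap K₁ L s₁) * s₂ := by
    have h := huvL
    have h16u := ha
    have h16v := hb
    simp only [map_add, map_mul, map_sub, map_ofNat, map_intCast, map_zero]
    linear_combination (16 : L) * h - algebraMap K L (b₀ : K) * h16u - (s₂ - (t : L)) * h16v
      - (algebraMap K L (b₁₂ : K) + algebraMap K L (b₁₃ : K) * algebraMap K₁ L s₁) * hS₂' - (algebraMap K L (b₁₃ : K)) * hS₁
  obtain ⟨e₀, e₁, e₂, e₃⟩ := coord4_unique_of_tower hs₁K hs₂K h16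
  have f₀ : a₀ * b₀ + (2 * b₁₂ + 2 * b₁₃ - b₁₀ * t) = 16 := by apply RingOfIntegers.coe_injective; push_cast; exact e₀
  have f₁ : a₁ * b₀ + (b₁₂ + 2 * b₁₃ - b₁₁ * t) = 0 := by apply RingOfIntegers.coe_injective; push_cast; exact e₁
  have f₂ : a₂ * b₀ + (b₁₀ - b₁₂ * t) = 0 := by apply RingOfIntegers.coe_injective; push_cast; exact e₂
  have f₃ : a₃ * b₀ + (b₁₁ - b₁₃ * t) = 0 := by apply RingOfIntegers.coe_injective; push_cast; exact e₃
  have g₀ := congrArg ψ f₀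
  have g₁ := congrArg ψ f₁
  have g₂ := congrArg ψ f₂
  have g₃ := congrArg ψ f₃
  simp only [map_add, map_mul, map_sub, map_ofNat, map_intCast, map_zero] at g₀ g₁ g₂ g₃
  set R₁ : ZMod q := (t : ZMod q) ^ 2 - 2 with hR₁def
  have hR₁ : R₁ ^ 2 = 2 := by rw [hR₁def]; linear_combination hPt
  have hT2 : (t : ZMod q) ^ 2 = R₁ + 2 := by rw [hR₁def]; ring
  have h16q : (16 : ZMod q) = 0 := by
    linear_combination ((-1)) * g₀ + ((-1) * R₁) * g₁ + ((-1) * (t : ZMod q)) * g₂ + ((-1) * R₁ * (t : ZMod q)) * g₃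
      + (ψ a₀ + ψ a₁ * R₁ + ψ a₂ * (t : ZMod q) + ψ a₃ * R₁ * (t : ZMod q)) * hψ + ((-1) * ψ b₁₃) * hR₁ + ((-1) * ψ b₁₂ + (-1) * ψ b₁₃ * R₁) * hT2
  haveI : Nontrivial (ZMod q) := ZMod.nontrivial_iff.mpr (by omega)
  have h1 : (1 : ZMod q) = 0 := by
    linear_combination (ti ^ 4) * h16q - (1 + 2 * ti + 4 * ti ^ 2 + 8 * ti ^ 3) * hti
  exact one_ne_zero h1

end Residue2

end Literature.NumberTheory.NumberFields

end
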